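import Mathlib.LinearAlgebra.FiniteDimensional.Lemmas
import Literature.Computability.MetaComplexity.ResolutionPlays
import Literature.Computability.MetaComplexity.ResLinRankStrategy
import Literature.Computability.MetaComplexity.GadgetClosure
import HarnessLib

/-!
# Resolution width lifts to Res(⊕) rank (Alekseev–Itsykson 2025, Theorem 3.1)

**Theorem** (`lt_resLinWidth_gadgetLift_of_forall_lt_resWidth`) [Alekseev–Itsykson, STOC 2025,
Thm 1.1 = Thm 3.1; ECCC TR24-128 p. 12]. Let `g : {0,1}^a → {0,1}` (`a ≥ 1`) be a 1-STIFLING gadget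
and `φ` a CNF all of whose resolution refutations have width `> w`. Then every Res(⊕) refutation
(resolution rule + SEMANTIC weakening, `IsResLinRefutation`) of the lifted formula
`φ ∘ g = gadgetLift a g φ` has a line `C` of RANK `rk(¬C) = linClauseRank C > w`:
`w < resLinWidth π`. In the words of the source: "if `Φ ∘ g` has a Res(⊕) refutation of rank `W`
then `Φ` has a resolution refutation of width at most `W`". The printed hypotheses "`Φ` a `k`-CNF,
`W ≥ k`" are not needed here (the tree's Atserias–Dalmau family `adGood_family` allows wide clauses
at the price of one unit of extension, which the `+1` of the tree's closure bound gives back).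

The proof is the paper's LIFTING OF STRATEGIES (§3): from the Atserias–Dalmau family of `φ` at
width `w` (`ResolutionPlays.adGood_family`: contains `∅`, down-closed, consistent with `φ`, extension
below `w` literals) we build a `(w+1)`-RANK-winning strategy for `φ ∘ g`
(`ResLinRankStrategy.IsRankWinningStrategy`), namely the family `liftedFamily a g φ w` of the
linear systems `F` with `rk F ≤ w + 1` admitting a set of blocks `Q` freeing the gadget values of
`F` outside `Q` (`GadgetClosure.GadgetFree`, the content of "`Q` is a closure of `L(F)`"), a member
`ρ` of the Atserias–Dalmau family assigning every block of `Q`, and a solution `σ` of `F` whose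
gadget values agree with `ρ` [Alekseev–Itsykson 2025, proof of Thm 3.1: "there exist `h ∈ 𝓗` and a
solution `σ` of `F` such that `σ̂` coincides with `h` on `Cl(L(F))`"]. The four strategy
properties are the four bullets of the paper's proof; the differences forced by the tree are
(i) the closure is existential (`exists_gadgetClosure`), so instead of the monotonicity of the
canonical closure the extension step RE-ALIGNS: it restricts `ρ` to the new closure, re-extends
it inside the Atserias–Dalmau family (`exists_adGood_extension`), and moves `σ` accordingly using
the freeness of the OLD closure; (ii) semantic consequence is handled by
`linFormVec_mem_span_of_imp` + `GadgetFree.mono`. Then Lemma 3.3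
(`IsRankWinningStrategy.lt_resLinWidth`) concludes.

NOT here: lifting to depth / size / regular Res(⊕) (the paper's Thms 1.2–1.5), 2-stifling gadgets,
the converse simulation (a width-`W` resolution refutation of `φ` gives a rank-`O(aW)` Res(⊕)
refutation of `φ ∘ g`).

## References

* Y. Alekseev, D. Itsykson, *Lifting to bounded-depth and regular resolutions over parities via
  games*, STOC 2025, 584–595 (= ECCC TR24-128, 2024), Thm 1.1 / Thm 3.1 and its proof, Lemmas
  2.9–2.10, 3.2–3.3 [AlekseevItsykson2025].
* A. Atserias, V. Dalmau, JCSS 74 (2008), Thm. 2 [AtseriasDalmau2008].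
* K. Efremenko, M. Garlík, D. Itsykson, STOC 2024, §4 (closure) [EfremenkoGarlikItsykson2024].
-/

namespace Literature.Computability.MetaComplexity

open _root_.Computability Complexity Finset Module

/-! ### Small facts on ranks, literal records and lifted clauses -/

/-- Adding one equation raises the rank by at most one. [Alekseev–Itsykson 2025, proof of Thm 3.1
("`rk(F) + 1 ≤ W + 1`")] [cite: AlekseevItsykson2025, Theorem 3.1 (proof)] -/
theorem linClauseRank_insert_le (e : LinLit) (F : Finset LinLit) :
    linClauseRank (insert e F) ≤ linClauseRank F + 1 := by
  classical
  have hforms : LinClause.forms (insert e F) = insert (linFormVec e.1) (LinClause.forms F) := by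
    ext v
    simp only [LinClause.mem_forms_iff, Finset.mem_insert, Set.mem_insert_iff]
    constructor
    · rintro ⟨l, rfl | hl, hv⟩
      · exact Or.inl hv.symm
      · exact Or.inr ⟨l, hl, hv⟩
    · rintro (rfl | ⟨l, hl, hv⟩)
      · exact ⟨e, Or.inl rfl, rfl⟩
      · exact ⟨l, Or.inr hl, hv⟩
  rw [linClauseRank_eq, linClauseRank_eq, hforms, Set.insert_eq, Submodule.span_union]
  haveI : Module.Finite (ZMod 2) (Submodule.span (ZMod 2) (LinClause.forms F)) :=
    Module.Finite.span_of_finite (ZMod 2) (Set.finite_range _)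
  haveI : Module.Finite (ZMod 2) (Submodule.span (ZMod 2) ({linFormVec e.1} : Set (ℕ → ZMod 2))) :=
    Module.Finite.span_of_finite (ZMod 2) (Set.finite_singleton _)
  have h1 : finrank (ZMod 2) (Submodule.span (ZMod 2) ({linFormVec e.1} : Set (ℕ → ZMod 2))) ≤ 1 :=
    (finrank_span_le_card ({linFormVec e.1} : Set (ℕ → ZMod 2))).trans (by simp)
  calc finrank (ZMod 2) ↥(Submodule.span (ZMod 2) ({linFormVec e.1} : Set (ℕ → ZMod 2)) ⊔
          Submodule.span (ZMod 2) (LinClause.forms F))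
      ≤ finrank (ZMod 2) (Submodule.span (ZMod 2) ({linFormVec e.1} : Set (ℕ → ZMod 2))) +
          finrank (ZMod 2) (Submodule.span (ZMod 2) (LinClause.forms F)) :=
        Submodule.finrank_add_le_finrank_add_finrank _ _
    _ ≤ finrank (ZMod 2) (Submodule.span (ZMod 2) (LinClause.forms F)) + 1 := by
        have := h1
        omega

/-- A record of true literals is FUNCTIONAL if it assigns at most one value to each variable.
[Atserias–Dalmau 2008, §2 (partial assignments)] [cite: AtseriasDalmau2008, §2] -/
def IsFunctionalRecord (ρ : Finset (Literal ℕ)) : Prop :=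
  ∀ l ∈ ρ, ∀ l' ∈ ρ, l.1 = l'.1 → l = l'

/-- A functional record has as many literals as variables. [folklore] -/
theorem IsFunctionalRecord.card_lvars {ρ : Finset (Literal ℕ)} (h : IsFunctionalRecord ρ) :
    (lvars ρ).card = ρ.card :=
  Finset.card_image_of_injOn fun l hl l' hl' heq => h l hl l' hl' heq

/-- Sub-records of functional records are functional. [folklore] -/
theorem IsFunctionalRecord.subset {ρ ρ' : Finset (Literal ℕ)} (h : IsFunctionalRecord ρ)
    (hsub : ρ' ⊆ ρ) : IsFunctionalRecord ρ' :=
  fun l hl l' hl' heq => h l (hsub hl) l' (hsub hl') heq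

/-- Extending a functional record at a fresh variable keeps it functional. [folklore] -/
theorem IsFunctionalRecord.insert {ρ : Finset (Literal ℕ)} (h : IsFunctionalRecord ρ) {x : ℕ}
    (hx : x ∉ lvars ρ) (b : Bool) : IsFunctionalRecord (insert (x, b) ρ) := by
  intro l hl l' hl' heq
  rcases Finset.mem_insert.1 hl with rfl | hlρ
  · rcases Finset.mem_insert.1 hl' with rfl | hl'ρ
    · rfl
    · obtain ⟨x', b'⟩ := l'
      simp only at heq
      subst heq
      exact absurd (mem_lvars.2 ⟨b', hl'ρ⟩) hx
  · rcases Finset.mem_insert.1 hl' with rfl | hl'ρ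
    · obtain ⟨x', b'⟩ := l
      simp only at heq
      subst heq
      exact absurd (mem_lvars.2 ⟨b', hlρ⟩) hx
    · exact h l hlρ l' hl'ρ heq

/-- The record of the gadget values of an assignment is functional: if `g(σ|block x) = b` for every
`(x, b) ∈ ρ` then `ρ` assigns one value per variable. [folklore] -/
theorem isFunctionalRecord_of_gadgetAssignment {a : ℕ} {g : (Fin a → Bool) → Bool} {σ : ℕ → Bool}
    {ρ : Finset (Literal ℕ)} (h : ∀ l ∈ ρ, gadgetAssignment a g σ l.1 = l.2) :
    IsFunctionalRecord ρ := by
  intro l hl l' hl' heq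
  have h1 := h l hl
  have h2 := h l' hl'
  rw [heq] at h1
  exact Prod.ext heq (h1.symm.trans h2)

/-- **Extension inside the Atserias–Dalmau family up to a prescribed domain.** If `ρ₀` is a
functional member of the family `ADGood φ w` with variables inside `T`, `|T| ≤ w`, then `ρ₀`
extends to a functional member with variable set exactly `T` (iterate the extension property,
available while the record has `< w` literals). [Alekseev–Itsykson 2025, proof of Thm 3.1 ("we can
extend `h` for all variables from `Cl(L(F) ∪ {f}) ∖ Cl(L(F))` one by one")]
[cite: AlekseevItsykson2025, Theorem 3.1 (proof, fourth property)] -/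
theorem exists_adGood_extension {φ : CNF ℕ} {w : ℕ}
    (hext : ∀ α : Finset (Literal ℕ), ADGood φ w α → α.card < w → ∀ x : ℕ,
      ∃ b : Bool, ADGood φ w (insert (x, b) α))
    (T : Finset ℕ) (hT : T.card ≤ w) :
    ∀ ρ₀ : Finset (Literal ℕ), ADGood φ w ρ₀ → IsFunctionalRecord ρ₀ → lvars ρ₀ ⊆ T →
      ∃ ρ : Finset (Literal ℕ), ADGood φ w ρ ∧ IsFunctionalRecord ρ ∧ ρ₀ ⊆ ρ ∧ lvars ρ = T := by
  classical
  -- induction on the number of missing variables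
  suffices key : ∀ m : ℕ, ∀ ρ₀ : Finset (Literal ℕ), (T \ lvars ρ₀).card = m → ADGood φ w ρ₀ →
      IsFunctionalRecord ρ₀ → lvars ρ₀ ⊆ T →
      ∃ ρ : Finset (Literal ℕ), ADGood φ w ρ ∧ IsFunctionalRecord ρ ∧ ρ₀ ⊆ ρ ∧ lvars ρ = T from
    fun ρ₀ h1 h2 h3 => key _ ρ₀ rfl h1 h2 h3
  intro m
  induction m with
  | zero =>
    intro ρ₀ hm hAD hfun hsub
    refine ⟨ρ₀, hAD, hfun, Finset.Subset.refl _, Finset.Subset.antisymm hsub ?_⟩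
    intro x hx
    by_contra hx'
    have : x ∈ T \ lvars ρ₀ := Finset.mem_sdiff.2 ⟨hx, hx'⟩
    rw [Finset.card_eq_zero.1 hm] at this
    exact absurd this (Finset.notMem_empty x)
  | succ m ih =>
    intro ρ₀ hm hAD hfun hsub
    -- a missing variable
    obtain ⟨x, hx⟩ : (T \ lvars ρ₀).Nonempty := by
      rw [← Finset.card_pos, hm]; exact Nat.succ_pos m
    obtain ⟨hxT, hxρ⟩ := Finset.mem_sdiff.1 hx
    -- the record is short enough to be extended
    have hcard : ρ₀.card < w := by
      rw [← hfun.card_lvars]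
      have hlt : (lvars ρ₀).card < T.card :=
        Finset.card_lt_card ⟨hsub, fun h => hxρ (h hxT)⟩
      omega
    obtain ⟨b, hb⟩ := hext ρ₀ hAD hcard x
    have hfun' : IsFunctionalRecord (insert (x, b) ρ₀) := hfun.insert hxρ b
    have hlv : lvars (insert (x, b) ρ₀) = insert x (lvars ρ₀) := by
      unfold lvars; rw [Finset.image_insert]
    have hsub' : lvars (insert (x, b) ρ₀) ⊆ T := by
      rw [hlv]; exact Finset.insert_subset hxT hsub
    have hm' : (T \ lvars (insert (x, b) ρ₀)).card = m := by
      rw [hlv]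
      have : T \ insert x (lvars ρ₀) = (T \ lvars ρ₀).erase x := by
        ext y
        simp only [Finset.mem_sdiff, Finset.mem_insert, Finset.mem_erase, not_or]
        tauto
      rw [this, Finset.card_erase_of_mem hx, hm]
      rfl
    obtain ⟨ρ, hρAD, hρfun, hρsub, hρT⟩ := ih _ hm' hb hfun' hsub'
    exact ⟨ρ, hρAD, hρfun, (Finset.subset_insert _ _).trans hρsub, hρT⟩

/-- **Lifted clauses follow their source clause** [Alekseev–Itsykson 2025, proof of Thm 3.1, second
bullet: "`τ` satisfies `C ∘ g` and, thus, `τ` satisfies `C'`"]: if `D` is a clause of `φ ∘ g` then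
`D` comes from a clause `c` of `φ`, and every assignment whose gadget values satisfy `c` satisfies
`D` (read as a linear clause). [cite: AlekseevItsykson2025, Theorem 3.1 (proof, second property)] -/
theorem exists_source_clause_of_mem_gadgetLift {a : ℕ} {g : (Fin a → Bool) → Bool} {φ : CNF ℕ}
    {D : Clause ℕ} (hD : D ∈ gadgetLift a g φ) :
    ∃ c ∈ φ, ∀ σ : ℕ → Bool, Clause.eval (gadgetAssignment a g σ) c = true →
      (Clause.toLinClause D).eval σ = true := by
  obtain ⟨c, hc, hDc⟩ := List.mem_flatMap.1 hD
  refine ⟨c, hc, fun σ hσ => ?_⟩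
  have h1 : (gadgetLiftClause a g c).eval σ = true := by
    rw [eval_gadgetLiftClause]
    exact hσ
  have h2 := (CNF.eval_eq_true_iff _ _).1 h1 D hDc
  rw [eval_toLinClause]
  exact h2

/-! ### The lifted strategy -/

/-- **The lifted family** `H̃` of [Alekseev–Itsykson 2025, proof of Thm 3.1]: the linear systems `F`
over the lifted variables with `rk F ≤ w + 1` for which there are a set of blocks `Q` freeing the
gadget values of `F` outside `Q` (a closure of `L(F)`), a member `ρ` of the Atserias–Dalmau family
of `φ` at width `w` assigning (at least) every block of `Q`, and a solution `σ` of `F` whose gadget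
values agree with `ρ` ("there exist `h ∈ 𝓗` and a solution `σ` of `F` such that `σ̂` coincides
with `h` on `Cl(L(F))`"). [cite: AlekseevItsykson2025, Theorem 3.1 (proof, the family H̃)] -/
def liftedFamily (a : ℕ) (g : (Fin a → Bool) → Bool) (φ : CNF ℕ) (w : ℕ) : Set (Finset LinLit) :=
  {F | linClauseRank F ≤ w + 1 ∧ ∃ Q : Finset ℕ, ∃ ρ : Finset (Literal ℕ), ∃ σ : ℕ → Bool,
    GadgetFree a g F Q ∧ ADGood φ w ρ ∧ Q ⊆ lvars ρ ∧
    (∀ e ∈ F, LinLit.eval σ e = true) ∧ (∀ l ∈ ρ, gadgetAssignment a g σ l.1 = l.2)}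

section Lifting

variable {a : ℕ} {g : (Fin a → Bool) → Bool} {φ : CNF ℕ} {w : ℕ}

/-- Membership in the lifted family, unfolded. [cite: AlekseevItsykson2025, Theorem 3.1 (proof, the family H̃)] -/
theorem mem_liftedFamily_iff {F : Finset LinLit} :
    F ∈ liftedFamily a g φ w ↔ linClauseRank F ≤ w + 1 ∧
      ∃ Q : Finset ℕ, ∃ ρ : Finset (Literal ℕ), ∃ σ : ℕ → Bool,
        GadgetFree a g F Q ∧ ADGood φ w ρ ∧ Q ⊆ lvars ρ ∧
        (∀ e ∈ F, LinLit.eval σ e = true) ∧ (∀ l ∈ ρ, gadgetAssignment a g σ l.1 = l.2) :=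
  Iff.rfl

/-- The empty system is in the lifted family (its closure is empty; the empty record is in the
Atserias–Dalmau family). [cite: AlekseevItsykson2025, Theorem 3.1 (proof)] -/
theorem empty_mem_liftedFamily (ha : 0 < a) (hg : IsStifling g)
    (hφ : ∀ π : List (ResLine ℕ), IsResRefutation φ π → w < resWidth π) :
    (∅ : Finset LinLit) ∈ liftedFamily a g φ w := by
  obtain ⟨Q, hQ, hfree⟩ := exists_gadgetClosure ha hg (∅ : Finset LinLit)
  have hQ0 : Q = ∅ := by
    rcases hQ with h | h
    · exact h
    · simp at h
  subst hQ0
  refine ⟨by simp, ∅, ∅, fun _ => false, hfree, (adGood_family hφ).1, by simp, by simp, by simp⟩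

/-- Property (2) of the lifted family [Alekseev–Itsykson 2025, proof of Thm 3.1, second bullet]:
every clause of `φ ∘ g` is satisfied by some solution of every member (the source clause is not
falsified by `ρ`: either `ρ` satisfies one of its literals — then `σ` does the job — or one of its
variables is unassigned, hence outside `Q`, and freeness sets its gadget value).
[cite: AlekseevItsykson2025, Theorem 3.1 (proof, second property)] -/
theorem liftedFamily_exists_sat {F : Finset LinLit} (hF : F ∈ liftedFamily a g φ w)
    {D : Clause ℕ} (hD : D ∈ gadgetLift a g φ) :
    ∃ σ : ℕ → Bool, (∀ e ∈ F, LinLit.eval σ e = true) ∧ (Clause.toLinClause D).eval σ = true := by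
  classical
  obtain ⟨-, Q, ρ, σ, hfree, hAD, hQρ, hσF, hσρ⟩ := hF
  obtain ⟨c, hc, hcD⟩ := exists_source_clause_of_mem_gadgetLift hD
  -- `ρ` does not falsify `c`: some literal `(x, b)` of `c` has `(x, ¬b) ∉ ρ`
  have hnf : ¬ Falsifies ρ c.toFinset := hAD.1 c hc
  unfold Falsifies at hnf
  push Not at hnf
  obtain ⟨l, hl, hneg⟩ := hnf
  rw [List.mem_toFinset] at hl
  obtain ⟨x, b⟩ := l
  by_cases hxb : (x, b) ∈ ρ
  · -- `ρ` satisfies the literal, hence so do the gadget values of `σ`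
    refine ⟨σ, hσF, hcD σ ?_⟩
    unfold Clause.eval
    rw [List.any_eq_true]
    refine ⟨(x, b), hl, ?_⟩
    simp [Literal.eval, hσρ (x, b) hxb]
  · -- `x` is unassigned, hence outside `Q`: set its gadget value to `b`
    have hx : x ∉ lvars ρ := by
      intro hx
      obtain ⟨b', hb'⟩ := mem_lvars.1 hx
      cases b <;> cases b'
      · exact hxb hb'
      · exact hneg hb'
      · exact hneg hb'
      · exact hxb hb'
    have hxQ : x ∉ Q := fun h => hx (hQρ h)
    obtain ⟨σ', hforms, -, hval⟩ := hfree σ (fun _ => b)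
    refine ⟨σ', solves_of_forms_eq hforms hσF, hcD σ' ?_⟩
    unfold Clause.eval
    rw [List.any_eq_true]
    refine ⟨(x, b), hl, ?_⟩
    simp [Literal.eval, hval x hxQ]

/-- Property (3) of the lifted family [Alekseev–Itsykson 2025, proof of Thm 3.1, third bullet]:
closure under semantic consequences of rank `≤ w + 1` (the forms of the consequence lie in
`⟨L(F)⟩`, so the same closure, record and solution witness it).
[cite: AlekseevItsykson2025, Theorem 3.1 (proof, third property)] -/
theorem liftedFamily_mem_of_imp {F : Finset LinLit} (hF : F ∈ liftedFamily a g φ w)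
    (G : Finset LinLit)
    (himp : ∀ σ : ℕ → Bool, (∀ e ∈ F, LinLit.eval σ e = true) → ∀ e ∈ G, LinLit.eval σ e = true)
    (hG : linClauseRank G ≤ w + 1) : G ∈ liftedFamily a g φ w := by
  obtain ⟨-, Q, ρ, σ, hfree, hAD, hQρ, hσF, hσρ⟩ := hF
  refine ⟨hG, Q, ρ, σ, ?_, hAD, hQρ, himp σ hσF, hσρ⟩
  refine hfree.mono fun e he => ?_
  exact linFormVec_mem_span_of_imp hσF (b := e.2) fun σ₁ hσ₁ => by
    rw [Prod.mk.eta]; exact himp σ₁ hσ₁ e he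

/-- Property (4) of the lifted family [Alekseev–Itsykson 2025, proof of Thm 3.1, fourth bullet]:
extension by any linear form below rank `w + 1`. Take a closure `Q'` of `L(F) ∪ {f}`
(`|Q'| ≤ rk F + 1 - 1 ≤ w`), restrict `ρ` to `Q'` and re-extend it inside the Atserias–Dalmau
family to a record `ρ'` on exactly `Q'`, move `σ` by the freeness of the OLD closure `Q` to a
solution `σ'` of `F` whose gadget values follow `ρ'`, and answer `f = f(σ')`.
[cite: AlekseevItsykson2025, Theorem 3.1 (proof, fourth property)] -/
theorem liftedFamily_exists_insert_mem (ha : 0 < a) (hg : IsStifling g)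
    (hφ : ∀ π : List (ResLine ℕ), IsResRefutation φ π → w < resWidth π)
    {F : Finset LinLit} (hF : F ∈ liftedFamily a g φ w) (hrank : linClauseRank F < w + 1)
    (f : Finset ℕ) : ∃ c : Bool, insert (f, c) F ∈ liftedFamily a g φ w := by
  classical
  obtain ⟨-, Q, ρ, σ, hfree, hAD, hQρ, hσF, hσρ⟩ := hF
  obtain ⟨-, hsub, -, hext⟩ := adGood_family hφ
  -- a closure of `L(F) ∪ {f}`
  obtain ⟨Q', hQ'size, hfree'⟩ := exists_gadgetClosure ha hg (insert (f, false) F)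
  have hQ'card : Q'.card ≤ w := by
    rcases hQ'size with h | h
    · rw [h, Finset.card_empty]; exact Nat.zero_le _
    · have := linClauseRank_insert_le (f, false) F
      omega
  -- restrict the record to `Q'` and re-extend it to exactly `Q'`
  have hρfun : IsFunctionalRecord ρ := isFunctionalRecord_of_gadgetAssignment hσρ
  set ρ₀ : Finset (Literal ℕ) := ρ.filter fun l => l.1 ∈ Q' with hρ₀
  have hρ₀sub : ρ₀ ⊆ ρ := Finset.filter_subset _ _
  have hρ₀AD : ADGood φ w ρ₀ := hsub ρ ρ₀ hAD hρ₀sub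
  have hρ₀fun : IsFunctionalRecord ρ₀ := hρfun.subset hρ₀sub
  have hρ₀vars : lvars ρ₀ ⊆ Q' := by
    intro x hx
    obtain ⟨b, hb⟩ := mem_lvars.1 hx
    exact (Finset.mem_filter.1 hb).2
  obtain ⟨ρ', hρ'AD, hρ'fun, hρ'sub, hρ'vars⟩ :=
    exists_adGood_extension hext Q' hQ'card ρ₀ hρ₀AD hρ₀fun hρ₀vars
  -- move `σ` so that its gadget values follow `ρ'`
  let τ : ℕ → Bool := fun x => decide ((x, true) ∈ ρ')
  obtain ⟨σ', hforms, hQblocks, hval⟩ := hfree σ τ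
  have hσ'F : ∀ e ∈ F, LinLit.eval σ' e = true := solves_of_forms_eq hforms hσF
  have hσ'ρ' : ∀ l ∈ ρ', gadgetAssignment a g σ' l.1 = l.2 := by
    intro l hl
    obtain ⟨x, b⟩ := l
    have hxQ' : x ∈ Q' := by rw [← hρ'vars]; exact mem_lvars.2 ⟨b, hl⟩
    by_cases hxQ : x ∈ Q
    · -- a block of the old closure: unchanged, and `ρ'` agrees with `ρ` there
      obtain ⟨b₀, hb₀⟩ := mem_lvars.1 (hQρ hxQ)
      have hb₀' : (x, b₀) ∈ ρ' := hρ'sub (Finset.mem_filter.2 ⟨hb₀, hxQ'⟩)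
      have hbb : b = b₀ := by
        have := hρ'fun (x, b) hl (x, b₀) hb₀' rfl
        exact (Prod.mk.inj this).2
      subst hbb
      have hblk : blockRestrict a σ' x = blockRestrict a σ x := by
        funext j; exact hQblocks x hxQ j
      show g (blockRestrict a σ' x) = b
      rw [hblk]
      exact hσρ (x, b) hb₀
    · -- a block outside the old closure: set by freeness to `τ x`
      show gadgetAssignment a g σ' x = b
      rw [hval x hxQ]
      cases b with
      | true => simp [τ, hl]
      | false =>
        have : (x, true) ∉ ρ' := fun h => by
          have := hρ'fun (x, false) hl (x, true) h rfl
          simp at this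
        simp [τ, this]
  -- answer `f` by its value at `σ'`
  refine ⟨LinLit.eval σ' (f, true), ?_, Q', ρ', σ', ?_, hρ'AD, by rw [hρ'vars], ?_, hσ'ρ'⟩
  · exact (linClauseRank_insert_le _ _).trans (by omega)
  · -- freeness of `Q'` for `F ∧ (f = c)` (same forms as `F ∧ (f = 0)`)
    refine hfree'.mono fun e he => Submodule.subset_span ?_
    rcases Finset.mem_insert.1 he with rfl | he
    · exact LinClause.mem_forms_iff.2 ⟨(f, false), Finset.mem_insert_self _ _, rfl⟩
    · exact LinClause.mem_forms_iff.2 ⟨e, Finset.mem_insert_of_mem he, rfl⟩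
  · -- `σ'` solves `F ∧ (f = f(σ'))`
    intro e he
    rcases Finset.mem_insert.1 he with rfl | he
    · cases h : LinLit.eval σ' (f, true)
      · have h1 := LinLit.eval_true_eq_not σ' f
        rw [h] at h1
        revert h1
        cases LinLit.eval σ' (f, false) <;> simp
      · exact h
    · exact hσ'F e he

/-- **The lifted family is a `(w+1)`-rank-winning strategy for `φ ∘ g`** [Alekseev–Itsykson 2025,
proof of Thm 3.1: "`H̃` satisfies all the properties of a `(W+1)`-winning Res(⊕)-strategy"].
[cite: AlekseevItsykson2025, Theorem 3.1 (proof)] -/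
theorem isRankWinningStrategy_liftedFamily (ha : 0 < a) (hg : IsStifling g)
    (hφ : ∀ π : List (ResLine ℕ), IsResRefutation φ π → w < resWidth π) :
    IsRankWinningStrategy (gadgetLift a g φ) (w + 1) (liftedFamily a g φ w) where
  nonempty := ⟨∅, empty_mem_liftedFamily ha hg hφ⟩
  rank_le _ hF := hF.1
  exists_sat _ hF _ hD := liftedFamily_exists_sat hF hD
  mem_of_imp _ hF G himp hG := liftedFamily_mem_of_imp hF G himp hG
  exists_insert_mem _ hF hrank f := liftedFamily_exists_insert_mem ha hg hφ hF hrank f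

end Lifting

/-! ### The lifting theorem -/

/-- **Resolution width lifts to Res(⊕) rank** [Alekseev–Itsykson 2025, Thm 1.1 = Thm 3.1]. Let
`g : {0,1}^a → {0,1}` (`a ≥ 1`) be a 1-stifling gadget and `φ` a CNF every resolution refutation
of which has width `> w`. Then every Res(⊕) refutation (resolution rule + semantic weakening) of the
lifted formula `φ ∘ g = gadgetLift a g φ` has a line `C` with `rk(¬C) = linClauseRank C > w`, i.e.
`w < resLinWidth π`. (The printed version assumes `φ` a `k`-CNF with `w ≥ k`; not needed here.)
[cite: AlekseevItsykson2025, Theorem 3.1] -/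
theorem lt_resLinWidth_gadgetLift_of_forall_lt_resWidth {a : ℕ} (ha : 0 < a)
    {g : (Fin a → Bool) → Bool} (hg : IsStifling g) {φ : CNF ℕ} {w : ℕ}
    (hφ : ∀ π : List (ResLine ℕ), IsResRefutation φ π → w < resWidth π)
    {π : List ResLinLine} (hπ : IsResLinRefutation (gadgetLift a g φ) π) : w < resLinWidth π :=
  (isRankWinningStrategy_liftedFamily ha hg hφ).lt_resLinWidth hπ

/-- Pointwise form: some line of the Res(⊕) refutation of `φ ∘ g` has rank `> w`.
[cite: AlekseevItsykson2025, Theorem 3.1] -/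
theorem exists_lt_linClauseRank_gadgetLift {a : ℕ} (ha : 0 < a)
    {g : (Fin a → Bool) → Bool} (hg : IsStifling g) {φ : CNF ℕ} {w : ℕ}
    (hφ : ∀ π : List (ResLine ℕ), IsResRefutation φ π → w < resWidth π)
    {π : List ResLinLine} (hπ : IsResLinRefutation (gadgetLift a g φ) π) :
    ∃ l ∈ π, w < linClauseRank l.clause :=
  lt_resLinWidth_iff.1 (lt_resLinWidth_gadgetLift_of_forall_lt_resWidth ha hg hφ hπ)

/-- The contrapositive, as printed [Alekseev–Itsykson 2025, Thm 3.1]: if `φ ∘ g` has a Res(⊕)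
refutation of rank `≤ W` (all lines of rank `≤ W`), then `φ` has a resolution refutation of width
`≤ W`. [cite: AlekseevItsykson2025, Theorem 3.1] -/
theorem exists_isResRefutation_resWidth_le_of_gadgetLift {a : ℕ} (ha : 0 < a)
    {g : (Fin a → Bool) → Bool} (hg : IsStifling g) {φ : CNF ℕ} {W : ℕ}
    {π : List ResLinLine} (hπ : IsResLinRefutation (gadgetLift a g φ) π) (hW : resLinWidth π ≤ W) :
    ∃ π₀ : List (ResLine ℕ), IsResRefutation φ π₀ ∧ resWidth π₀ ≤ W := by
  by_contra h
  push Not at h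
  exact absurd hW (not_le.2 (lt_resLinWidth_gadgetLift_of_forall_lt_resWidth ha hg h hπ))

/-- `ℕ∞` form: the minimal Res(⊕) rank-width of `φ ∘ g` is at least `w + 1` whenever every
resolution refutation of `φ` has width `> w`. [cite: AlekseevItsykson2025, Theorem 3.1] -/
theorem le_minResLinWidth_gadgetLift {a : ℕ} (ha : 0 < a)
    {g : (Fin a → Bool) → Bool} (hg : IsStifling g) {φ : CNF ℕ} {w : ℕ}
    (hφ : ∀ π : List (ResLine ℕ), IsResRefutation φ π → w < resWidth π) :
    ((w + 1 : ℕ) : ℕ∞) ≤ minResLinWidth (gadgetLift a g φ) := by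
  unfold minResLinWidth
  refine le_iInf₂ fun π hπ => ?_
  exact_mod_cast lt_resLinWidth_gadgetLift_of_forall_lt_resWidth ha hg hφ hπ

end Literature.Computability.MetaComplexity
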